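import Summits.QuantumFields.YangMills.Theorems.BalabanUVNodesN15UnitLayerBgFamilyLetters
import Summits.QuantumFields.YangMills.Theorems.BalabanUVNodesN15TwoGridDressedJetNoFitFullG
import Summits.QuantumFields.YangMills.Theorems.BalabanUVNodesN15FullPropagatorEntry2Rows
import HarnessLib

/-!
# N15 (NE2) — PROGRAMME Λ-U «THE UNIT LAYER OF THE PAIR OF RECORD WITH THE BACKGROUND LIVE UNDER THE (3.35) PAIR ALONE», part Λ-E: THE THREE BOND-MATRIX LETTERS OF THE
# MIDDLE FACTOR `Z(U) = Q(E₀(U) − G)Q*` ON THE (3.35)-PAIR COEFFICIENT FAMILY (sup letters of `c′, a′_μ` + ONE fit of `a′`; NO `∇c′`, NO `∇∇a′`), uniformly on the torus family of record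

WHO ∕ WHEN.  Cell `pub-ymgap`, seat `pub-ymgap-dag-n15-a` (KNIT-BY-NAME seat of Track-A DAG node N15 = NE2, g27); `--kind proof --supports stmt-QuantumFields-27366 --as helper` (K3⁸;
count-neutral).  THEOREMS ONLY (0 `def`).  Over g16's U-C `…UnitLayerBgTorusLetters` (`e0Op`, `wOp`, `zOp`, `isUnit_pair`, `hasMaj_VX`, `hasMaj_wOp`, `hasMaj_zOp`, `hasMaj_grad_wOp_qvAdj`,
`idef_sub_sub`, `hasMaj_zOp_sub`), U-C2 `…UnitLayerBgFamilyLetters` (`unitBondMat`, `unitBondMat_sub`, `abs_unitBondMat_le_of_hasMaj`, `inv_pow_le_sixteenth`), dag-n15-c FILE 8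
`uniform_layer_fullG` (the uniform `U ≡ 1` rows of `Δ_a⁻¹`, `∇Δ_a⁻¹` and their η-defects, `fgD` form), W `symbOp_sD_eq`, K-J ★★ `hasMaj_projO_idef_bgPair_gOp` (entry 0 of the dressed jet
under the (3.35) pair), n15-b `abs_blockAvg_le` BY NAME; nothing in the tree is modified.  PATTERN = U-C2∕U-C3 (`hasMaj_zOp_letters_at`, `zOp_family_letters`) on dag-n15-c's primitive carrier.

WHY.  U-D's unit layer (`ne2PlusUnit_tgCovBg`, the (2.156) covariance dressed through the operator layer's own dressed propagator) reads the background through the three letters of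
`Z(U)`; U-C2 derived them from n15-b's B4 entry-0 defect, which needs the FIT LETTERS OF `c′` (dag-n15-c's primitive `Reg335`: `|U|, |∇′U|, |∇′∇′U|`), and on a family with `M = 1`
(fails the K3⁸ guard `Live`).  Programme Λ's carrier `coeffBgFO` has the (3.35) pair alone and Bałaban's size `M` live; the one changed input is the η-defect of the increment
`𝔇(W′, W̄) = 𝔇(E₀′(U), E₀(Ū)) − 𝔇(G′, Ḡ)` — K-J's entry 0 of the dressed jet (no `∇c′`, no fit of `c′`) minus entry 0, once `E₀ = pr₀ bgPair G (fgD) c a` is identified with the jet of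
record `pr₀ bgPair G (ρ(sD_μ)∘G)_μ c a` (W `symbOp_sD_eq`: `ρ(n(s_μ − 1)) = fgrad n (bshift_μ)`).

WHAT.  §1 `fgD_eq_symbOp_comp`, `e0Op_eq_bgPair_symbOp`, `idef_e0Op_eq`, `idef_wOp_eq` (the bridge, generic torus).  §2 ★★★ **`zOp_letters_FO (hLodd) (hL3 : 3 ≤ L) (hL) (hb : 0 < b) :
∃ δ_Z ζ τ r₁ > 0, ∀ (i : TGIndex) (r ∈ [0, r₁]) (o_a ≥ 0) (c′ a′) (|c′|, |a′_μ| ≤ r) (|a′_μ − ā_μ∘kingPrV| ≤ o_a)`**, with `M = TGIndex.Mn d hL i`, `Z̄ = Z^{(L^k)}(c̄, ā)` at the block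
averages, `Z′ = Z^{(L^mL^k)}(c′, a′)`: **`|Z̄(b,b′)|, |Z′(b,b′)| ≤ ζ·r·e^{−δ_Zρ_M(b₋,b′₋)}` and `|Z′(b,b′) − Z̄(b,b′)| ≤ τ·((L^k)^{−1∕16} + r(L^k)^{−1∕(8(d+1))} + o_a)·e^{−δ_Zρ_M(b₋,b′₋)}`** —
LINEAR in the sup letter `r`, the difference at K-J's rate shape; window `r₁ := min r₀^J (2β(d+2)c_r + 1)⁻¹`.

HONEST FRAMING ∕ LIMITS.  Count-neutral assembly of LANDED rows; MODEL-LEVEL: abelianised first-order species of (3.52)'s `V′(A)`, block-averaged coarse partner (C3), abelianised `Q`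
(`qvRe`∕`qvAdjRe` real parts); GENUINE: Bałaban's `Δ_a⁻¹` on the torus family of record and its (1.110) rows.  The perturbed (2.156) covariance and the `NE2PlusUnit`∕`N15At` packaging are
the sequel Λ-F.  NE2⁺ ∕ [B9] Thm 3.15 at general `U` NOT PRINTED as η-rates, NOT proved; no statement of record touched; N15 NOT discharged; K3⁸ OPEN; counts UNMOVED (typed 28∕28 · discharged
6∕28 of record); one finite torus per index — NOT ℝ⁴ ∕ infinite volume ∕ OS ∕ mass gap ∕ Clay.  ONE declared `set_option maxHeartbeats 1600000 in` on ★★★ (three-letter assembly over long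
operator terms).
-/

noncomputable section

open scoped BigOperators
open Finset

namespace Summit.QuantumFields.YangMills.BalabanUVNodes.N15.UnitLayerBg

open Literature.MathematicalPhysics.QuantumFieldTheory.Balaban1983to89
open Literature.MathematicalPhysics.QuantumFieldTheory.Balaban1983to89.B11SectG (BlockNorm HasMaj)
open Literature.MathematicalPhysics.QuantumFieldTheory.Balaban1983to89.T4EtaRateDefect (idef)
open Literature.MathematicalPhysics.QuantumFieldTheory.Balaban1983to89.T4EtaRateCoeffDefect (pull blockAvg)
open Literature.MathematicalPhysics.QuantumFieldTheory.Balaban1983to89.B5Prop11Plancherel (Tor fine)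
open Literature.MathematicalPhysics.QuantumFieldTheory.Balaban1983to89.B5SiteBridgeP12 (MP)
open Literature.MathematicalPhysics.QuantumFieldTheory.Balaban1983to89.B6UnitTorusCarrier (unitTorusGeo)
open Literature.MathematicalPhysics.QuantumFieldTheory.Balaban1983to89.B4Sect5Proof (latticeConst latticeConst_nonneg)
open Literature.MathematicalPhysics.QuantumFieldTheory.Balaban1983to89.B6Lemma24Torus (pbox)
open Literature.MathematicalPhysics.QuantumFieldTheory.Balaban1983to89.B6BondEliminationTorus (pdist)
open Literature.MathematicalPhysics.QuantumFieldTheory.Balaban1983to89.B6Cov2156Torus (one_le_M)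
open Literature.MathematicalPhysics.QuantumFieldTheory.King1986 (exp_decay_mono)
open Literature.MathematicalPhysics.QuantumFieldTheory.King1986.Torus (blockOf tdistT tdistT_nonneg)
open Summit.QuantumFields.YangMills.BalabanUVNodes.N15.TwoGrid (gOp symbOp sD qvRe qvAdjRe TGIndex paramsOf hasMaj_projO_idef_bgPair_gOp)
open Summit.QuantumFields.YangMills.BalabanUVNodes.N15.VectorPiece (blkFine kingPrV blkFine_comp_kingPrV bshiftEquiv)
open Summit.QuantumFields.YangMills.BalabanUVNodes.N15.BackgroundLayer (bgPair projO unstack fgD fgrad uniform_layer_fullG abs_blockAvg_le symbOp_sD_eq)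

variable {d : ℕ} {L : ℕ} [NeZero L]

/-! ## §1 The bridge: U-C's `E₀(U)` IS the dressed value of the jet of record -/

section Bridge

variable (M : Fin (d + 1) → ℕ) [∀ μ, NeZero (M μ)] (n : ℕ) [NeZero n] (b : ℝ)

omit [NeZero L] in
/-- dag-n15-c's derived pieces ARE the jet of record's: `fgD_μ = fgrad n (bshift_μ)∘G = ρ(sD_μ(n))∘G` (W `symbOp_sD_eq`). [cite: Balaban1984PropagatorsI, (1.3) p.18 (the difference operators: shape)] -/
theorem fgD_eq_symbOp_comp : fgD d M n b = fun μ => symbOp M n (sD M n μ ((n : ℕ) : ℝ)) ∘ₗ gOp M n b := by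
  funext μ
  rw [fgD, symbOp_sD_eq]

omit [NeZero L] in
/-- `E₀(U) = pr₀ bgPair G (ρ(sD_μ)∘G)_μ c a` — U-C's dressed propagator IS the value component of the first-order jet of record. [cite: Balaban1985BackgroundPropagators, (3.64)–(3.65) p.403 (shape)] -/
theorem e0Op_eq_bgPair_symbOp (c : Tor (fine n M) × Fin (d + 1) → ℝ) (a : Fin (d + 1) → Tor (fine n M) × Fin (d + 1) → ℝ) :
    e0Op d M n b c a = projO none ∘ₗ bgPair (gOp M n b) (fun μ => symbOp M n (sD M n μ ((n : ℕ) : ℝ)) ∘ₗ gOp M n b) c a := by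
  rw [e0Op, fgD_eq_symbOp_comp]

variable {M n b} (k m : ℕ)

/-- the η-defect of `E₀` through King's prolongation IS entry 0 of the dressed jet of record. [cite: King1986, p.664 (the pairing)] [folklore] -/
theorem idef_e0Op_eq (c : Tor (fine (L ^ k) M) × Fin (d + 1) → ℝ) (a : Fin (d + 1) → Tor (fine (L ^ k) M) × Fin (d + 1) → ℝ)
    (c' : Tor (fine (L ^ m * L ^ k) M) × Fin (d + 1) → ℝ) (a' : Fin (d + 1) → Tor (fine (L ^ m * L ^ k) M) × Fin (d + 1) → ℝ) :
    idef (pull (kingPrV L k m M)) (pull (kingPrV L k m M)) (e0Op d M (L ^ m * L ^ k) b c' a') (e0Op d M (L ^ k) b c a) =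
      idef (pull (kingPrV L k m M)) (pull (kingPrV L k m M))
        (projO none ∘ₗ bgPair (gOp M (L ^ m * L ^ k) b) (fun μ => symbOp M (L ^ m * L ^ k) (sD M (L ^ m * L ^ k) μ ((L ^ m * L ^ k : ℕ) : ℝ)) ∘ₗ gOp M (L ^ m * L ^ k) b) c' a')
        (projO none ∘ₗ bgPair (gOp M (L ^ k) b) (fun μ => symbOp M (L ^ k) (sD M (L ^ k) μ ((L ^ k : ℕ) : ℝ)) ∘ₗ gOp M (L ^ k) b) c a) := by
  rw [e0Op_eq_bgPair_symbOp, e0Op_eq_bgPair_symbOp]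

/-- `𝔇(W′, W) = 𝔇(E₀′, E₀) − 𝔇(G′, G)` (`W = E₀ − G`, `idef_sub_sub`). [folklore] -/
theorem idef_wOp_eq (c : Tor (fine (L ^ k) M) × Fin (d + 1) → ℝ) (a : Fin (d + 1) → Tor (fine (L ^ k) M) × Fin (d + 1) → ℝ)
    (c' : Tor (fine (L ^ m * L ^ k) M) × Fin (d + 1) → ℝ) (a' : Fin (d + 1) → Tor (fine (L ^ m * L ^ k) M) × Fin (d + 1) → ℝ) :
    idef (pull (kingPrV L k m M)) (pull (kingPrV L k m M)) (wOp d M (L ^ m * L ^ k) b c' a') (wOp d M (L ^ k) b c a) =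
      idef (pull (kingPrV L k m M)) (pull (kingPrV L k m M)) (e0Op d M (L ^ m * L ^ k) b c' a') (e0Op d M (L ^ k) b c a)
        - idef (pull (kingPrV L k m M)) (pull (kingPrV L k m M)) (gOp M (L ^ m * L ^ k) b) (gOp M (L ^ k) b) := by
  unfold wOp
  exact idef_sub_sub _ _ _ _ _

end Bridge

/-! ## §2 ★★★ The three letters of the middle factor on the (3.35)-pair family, uniformly -/

section Letters

variable (d)

set_option maxHeartbeats 1600000 in
/-- ★★★ **THE THREE BOND-MATRIX LETTERS OF `Z(U) = Q(E₀(U) − G)Q*` UNDER THE (3.35) PAIR ALONE, UNIFORM ON THE TORUS FAMILY OF RECORD.**  See the module docstring (WHAT).  Rows: dag-n15-c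
FILE 8 `uniform_layer_fullG` at `γ = 1∕16` (`G`, `fgD_μ` on both grids, `𝔇(G′, G)`), K-J ★★ entry 0 of the dressed jet (`𝔇(E₀′, E₀)` through §1), U-C's letters (`hasMaj_wOp`, `hasMaj_zOp`,
`hasMaj_VX`, `hasMaj_grad_wOp_qvAdj`, `hasMaj_zOp_sub`), U-C2's dictionary `abs_unitBondMat_le_of_hasMaj`; `σ = ρ∕4`, rows at `ρ = min(δ, δ_E)`, letters at `ρ∕2`, output at `ρ∕4`.
[cite: Balaban1985BackgroundPropagators, (3.35) p.396, (3.52) p.400, (3.63)–(3.65) pp.402–403 (shapes, mechanism); Balaban1984PropagatorsI, (1.18) p.20, (1.65)–(1.66) p.29, Prop. 1.2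
(1.110)–(1.111) p.35; King1986, p.664 (pairing), Lemma 4.5 (4.38) p.674 (shape); Balaban1984PropagatorsII, Lemma 2.1 (2.61) p.234] -/
theorem zOp_letters_FO (hLodd : Odd L) (hL3 : 3 ≤ L) (hL : Odd L ∧ 1 < L) {b : ℝ} (hb : 0 < b) :
    ∃ δZ ζ τ r₁ : ℝ, 0 < δZ ∧ 0 < ζ ∧ 0 < τ ∧ 0 < r₁ ∧
      ∀ (i : TGIndex) (r : ℝ), 0 ≤ r → r ≤ r₁ → ∀ (oa : ℝ), 0 ≤ oa →
        ∀ (c' : Tor (fine (L ^ i.m * L ^ i.k) (TGIndex.Mn d hL i)) × Fin (d + 1) → ℝ) (a' : Fin (d + 1) → Tor (fine (L ^ i.m * L ^ i.k) (TGIndex.Mn d hL i)) × Fin (d + 1) → ℝ),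
        (∀ z, |c' z| ≤ r) → (∀ μ z, |a' μ z| ≤ r) → (∀ μ z, |a' μ z - blockAvg (kingPrV L i.k i.m (TGIndex.Mn d hL i)) (a' μ) (kingPrV L i.k i.m (TGIndex.Mn d hL i) z)| ≤ oa) →
          (∀ p q : B4.Idx (pbox (TGIndex.Mn d hL i)) (d + 1),
              |unitBondMat (TGIndex.Mn d hL i) (zOp d (TGIndex.Mn d hL i) (L ^ i.k) b (blockAvg (kingPrV L i.k i.m (TGIndex.Mn d hL i)) c')
                  (fun μ => blockAvg (kingPrV L i.k i.m (TGIndex.Mn d hL i)) (a' μ))) p q|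
                ≤ ζ * r * Real.exp (-(δZ * pdist (TGIndex.Mn d hL i) (one_le_M _) (p.1 : Fin (d + 1) → ℤ) (q.1 : Fin (d + 1) → ℤ)))) ∧
          (∀ p q : B4.Idx (pbox (TGIndex.Mn d hL i)) (d + 1),
              |unitBondMat (TGIndex.Mn d hL i) (zOp d (TGIndex.Mn d hL i) (L ^ i.m * L ^ i.k) b c' a') p q|
                ≤ ζ * r * Real.exp (-(δZ * pdist (TGIndex.Mn d hL i) (one_le_M _) (p.1 : Fin (d + 1) → ℤ) (q.1 : Fin (d + 1) → ℤ)))) ∧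
          (∀ p q : B4.Idx (pbox (TGIndex.Mn d hL i)) (d + 1),
              |unitBondMat (TGIndex.Mn d hL i) (zOp d (TGIndex.Mn d hL i) (L ^ i.m * L ^ i.k) b c' a') p q -
                  unitBondMat (TGIndex.Mn d hL i) (zOp d (TGIndex.Mn d hL i) (L ^ i.k) b (blockAvg (kingPrV L i.k i.m (TGIndex.Mn d hL i)) c')
                    (fun μ => blockAvg (kingPrV L i.k i.m (TGIndex.Mn d hL i)) (a' μ))) p q|
                ≤ τ * (((L ^ i.k : ℕ) : ℝ) ^ (-(1 / 16 : ℝ)) + r * ((L ^ i.k : ℕ) : ℝ) ^ (-(1 / (8 * ((d : ℝ) + 1)))) + oa) *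
                    Real.exp (-(δZ * pdist (TGIndex.Mn d hL i) (one_le_M _) (p.1 : Fin (d + 1) → ℤ) (q.1 : Fin (d + 1) → ℤ)))) := by
  have hL2 : 2 ≤ L := by omega
  have hL1r : (1 : ℝ) ≤ (L : ℝ) := by exact_mod_cast (show 1 ≤ L by omega)
  have hd0 : (0 : ℝ) ≤ d := Nat.cast_nonneg d
  -- the uniform `U ≡ 1` rows (FILE 8) and K-J's entry 0
  obtain ⟨δ, β, m₀, cT, mT', hδ, -, hβ, hm₀, -, -, -, H⟩ :=
    uniform_layer_fullG (d := d) hLodd hL2 hL hb (γ := (1 / 16 : ℝ)) (by norm_num) le_rfl 1 (δ₂ := 1) (B₂ := 0) one_pos le_rfl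
  obtain ⟨δE, rE, BE, hδE, hrE, hBE, HE⟩ := hasMaj_projO_idef_bgPair_gOp d hLodd hL3 hb
  -- one rate
  obtain ⟨ρ, hρ⟩ : ∃ ρ : ℝ, ρ = min δ δE := ⟨_, rfl⟩
  have hρpos : 0 < ρ := hρ ▸ lt_min hδ hδE
  have hρδ : ρ ≤ δ := hρ ▸ min_le_left _ _
  have hρE : ρ ≤ δE := hρ ▸ min_le_right _ _
  have hσ : 0 < ρ / 4 := by positivity
  obtain ⟨cr, hcr⟩ : ∃ x : ℝ, latticeConst (d + 1) (ρ / 4) = x := ⟨_, rfl⟩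
  have hcr0 : 0 ≤ cr := hcr ▸ latticeConst_nonneg (d + 1) hσ.le
  obtain ⟨ee, hee⟩ : ∃ x : ℝ, Real.exp ρ = x := ⟨_, rfl⟩
  have hee1 : 1 ≤ ee := hee ▸ Real.one_le_exp hρpos.le
  have hee0 : 0 ≤ ee := zero_le_one.trans hee1
  -- the window and the constants
  set W : ℝ := β * ((d : ℝ) + 2) * cr with hW_def
  have hW0 : 0 ≤ W := by positivity
  have hr₁' : 0 < (2 * W + 1)⁻¹ := by positivity
  set r₁ : ℝ := min rE (2 * W + 1)⁻¹ with hr₁_def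
  have hr₁ : 0 < r₁ := lt_min hrE hr₁'
  set ζ₀ : ℝ := 2 * β ^ 2 * ((d : ℝ) + 2) * cr with hζ₀_def
  have hζ₀ : 0 ≤ ζ₀ := by positivity
  obtain ⟨ζ, hζ⟩ : ∃ x : ℝ, x = ζ₀ * ee * cr * ee + 1 := ⟨_, rfl⟩
  have hζpos : 0 < ζ := hζ ▸ by positivity
  obtain ⟨τ, hτ⟩ : ∃ x : ℝ, x = ζ₀ * r₁ * 2 * ee * cr * ee + (BE + m₀) * ee * cr * ee + β * (2 * β * ((d : ℝ) + 2) * r₁) * ee * cr * cr * ee + 1 := ⟨_, rfl⟩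
  have hτpos : 0 < τ := hτ ▸ by positivity
  refine ⟨ρ / 4, ζ, τ, r₁, hσ, hζpos, hτpos, hr₁, ?_⟩
  intro i r hr hrr₁ oa hoa c' a' hc' ha' hfa
  have hrrE : r ≤ rE := hrr₁.trans (min_le_left _ _)
  have hrrW : r ≤ (2 * W + 1)⁻¹ := hrr₁.trans (min_le_right _ _)
  have hLk : (1 : ℝ) ≤ (L : ℝ) ^ i.k := one_le_pow₀ hL1r
  have hLk0 : (0 : ℝ) < (L : ℝ) ^ i.k := by positivity
  have hcast : (((L ^ i.k : ℕ) : ℝ)) = (L : ℝ) ^ i.k := by push_cast; ring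
  -- atoms of the rate shape
  obtain ⟨θ, hθ⟩ : ∃ x : ℝ, ((L ^ i.k : ℕ) : ℝ) ^ (-(1 / 16 : ℝ)) = x := ⟨_, rfl⟩
  obtain ⟨θ', hθ'⟩ : ∃ x : ℝ, ((L ^ i.k : ℕ) : ℝ) ^ (-(1 / (8 * ((d : ℝ) + 1)))) = x := ⟨_, rfl⟩
  have hθ0 : 0 ≤ θ := hθ ▸ Real.rpow_nonneg (Nat.cast_nonneg _) _
  have hθ'0 : 0 ≤ θ' := hθ' ▸ Real.rpow_nonneg (Nat.cast_nonneg _) _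
  have hθpow : ((L : ℝ) ^ i.k) ^ (-(1 / 16 : ℝ)) = θ := by rw [← hθ, hcast]
  have hθinv : ((L : ℝ) ^ i.k)⁻¹ ≤ θ := by rw [← hθpow]; exact inv_pow_le_sixteenth hL1r i.k
  have hLinv0 : 0 ≤ ((L : ℝ) ^ i.k)⁻¹ := inv_nonneg.mpr hLk0.le
  obtain ⟨T, hT⟩ : ∃ x : ℝ, x = θ + r * θ' + oa := ⟨_, rfl⟩
  have hT0 : 0 ≤ T := hT ▸ add_nonneg (add_nonneg hθ0 (mul_nonneg hr hθ'0)) hoa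
  have hθT : θ ≤ T := by rw [hT]; linarith [mul_nonneg hr hθ'0]
  -- the rows at this index
  obtain ⟨hG, hD, hG', hD', -, hDG, -, -⟩ := H (i, (0 : Fin (d + 1)))
  rw [hθpow] at hDG
  -- coarse coefficients = block averages; the guard
  have hc : ∀ x, |blockAvg (kingPrV L i.k i.m (TGIndex.Mn d hL i)) c' x| ≤ r := fun x => abs_blockAvg_le _ hr hc' x
  have ha : ∀ μ x, |blockAvg (kingPrV L i.k i.m (TGIndex.Mn d hL i)) (a' μ) x| ≤ r := fun μ x => abs_blockAvg_le _ hr (ha' μ) x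
  have h1 : (2 * W + 1)⁻¹ * (2 * W + 1) = 1 := inv_mul_cancel₀ (by positivity)
  have hqle : β * (r * ((d : ℝ) + 2)) * latticeConst (d + 1) (ρ / 4) ≤ 1 / 2 := by
    rw [hcr]
    calc β * (r * ((d : ℝ) + 2)) * cr = r * W := by rw [hW_def]; ring
      _ ≤ (2 * W + 1)⁻¹ * W := mul_le_mul_of_nonneg_right hrrW hW0
      _ ≤ 1 / 2 := by linarith [h1, hr₁'.le]
  have hq : β * (r * ((d : ℝ) + 2)) * latticeConst (d + 1) (ρ / 4) < 1 := by linarith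
  have hinv : (1 - β * (r * ((d : ℝ) + 2)) * latticeConst (d + 1) (ρ / 4))⁻¹ ≤ 2 := B9SectDSup.inv_one_sub_le_two hqle
  have hinv0 : 0 ≤ (1 - β * (r * ((d : ℝ) + 2)) * latticeConst (d + 1) (ρ / 4))⁻¹ := inv_nonneg.mpr (by linarith)
  -- rates
  have hρ₁ : 0 ≤ ρ - ρ / 4 := by linarith
  have hρ₁δ : ρ - ρ / 4 + ρ / 4 ≤ δ := by linarith
  -- (i) the increments (U-C `hasMaj_wOp`), coarse and fine
  have hW := hasMaj_wOp (L := L) (M := TGIndex.Mn d hL i) i.k (blkFine L i.k (TGIndex.Mn d hL i)) hβ.le hr hσ hρ₁ hρ₁δ hG hD hc ha hq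
  have hW' := hasMaj_wOp (L := L) (M := TGIndex.Mn d hL i) i.k (blkFine L i.k (TGIndex.Mn d hL i) ∘ kingPrV L i.k i.m (TGIndex.Mn d hL i)) hβ.le hr hσ hρ₁ hρ₁δ hG' hD' hc' ha' hq
  rw [blkFine_comp_kingPrV] at hW'
  -- the amplitudes `A = r(d+2)·β(1−q)⁻¹ ≤ 2β(d+2)·r`, `BW = β·A·c_r ≤ ζ₀·r`
  obtain ⟨A, hA⟩ : ∃ x : ℝ, r * ((d : ℝ) + 2) * (β * (1 - β * (r * ((d : ℝ) + 2)) * latticeConst (d + 1) (ρ / 4))⁻¹) = x := ⟨_, rfl⟩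
  have hA0 : 0 ≤ A := hA ▸ mul_nonneg (by positivity) (mul_nonneg hβ.le hinv0)
  have hAle : A ≤ 2 * β * ((d : ℝ) + 2) * r := by
    rw [← hA]
    have e1 : β * (1 - β * (r * ((d : ℝ) + 2)) * latticeConst (d + 1) (ρ / 4))⁻¹ ≤ β * 2 := mul_le_mul_of_nonneg_left hinv hβ.le
    calc r * ((d : ℝ) + 2) * (β * (1 - β * (r * ((d : ℝ) + 2)) * latticeConst (d + 1) (ρ / 4))⁻¹) ≤ r * ((d : ℝ) + 2) * (β * 2) :=
          mul_le_mul_of_nonneg_left e1 (by positivity)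
      _ = _ := by ring
  obtain ⟨BW, hBW⟩ : ∃ x : ℝ, β * (r * ((d : ℝ) + 2) * (β * (1 - β * (r * ((d : ℝ) + 2)) * latticeConst (d + 1) (ρ / 4))⁻¹)) * latticeConst (d + 1) (ρ / 4) = x := ⟨_, rfl⟩
  have hBWA : BW = β * A * cr := by rw [← hBW, ← hA, ← hcr]
  have hBW0 : 0 ≤ BW := by rw [hBWA]; positivity
  have hBWle : BW ≤ ζ₀ * r := by
    rw [hBWA, hζ₀_def]
    calc β * A * cr ≤ β * (2 * β * ((d : ℝ) + 2) * r) * cr := mul_le_mul_of_nonneg_right (mul_le_mul_of_nonneg_left hAle hβ.le) hcr0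
      _ = _ := by ring
  rw [hBW] at hW hW'
  -- (ii) the middle factors (U-C `hasMaj_zOp`) at rate `ρ∕2`
  have hZ := hasMaj_zOp (L := L) (M := TGIndex.Mn d hL i) (k := i.k) (σ := ρ / 4) (ρ := ρ - ρ / 4) hBW0 hσ (by linarith) hW
  have hZ' := hasMaj_zOp (L := L) (M := TGIndex.Mn d hL i) (k := i.k) (σ := ρ / 4) (ρ := ρ - ρ / 4) hBW0 hσ (by linarith) hW'
  rw [hcr] at hZ hZ'
  have hexpa : Real.exp (ρ - ρ / 4) ≤ ee := hee ▸ Real.exp_le_exp.mpr (by linarith)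
  have hexpb : Real.exp (ρ - ρ / 4 - ρ / 4) ≤ ee := hee ▸ Real.exp_le_exp.mpr (by linarith)
  have hexpc : Real.exp (ρ / 2) ≤ ee := hee ▸ Real.exp_le_exp.mpr (by linarith)
  have hexpd : Real.exp (ρ / 2 - ρ / 4) ≤ ee := hee ▸ Real.exp_le_exp.mpr (by linarith)
  have hZamp : 1 * BW * (1 * Real.exp (ρ - ρ / 4)) * cr * Real.exp (ρ - ρ / 4 - ρ / 4) ≤ ζ * r := by
    rw [hζ]
    calc 1 * BW * (1 * Real.exp (ρ - ρ / 4)) * cr * Real.exp (ρ - ρ / 4 - ρ / 4) = BW * (Real.exp (ρ - ρ / 4) * (cr * Real.exp (ρ - ρ / 4 - ρ / 4))) := by ring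
      _ ≤ (ζ₀ * r) * (ee * (cr * ee)) :=
          mul_le_mul hBWle (mul_le_mul hexpa (mul_le_mul_of_nonneg_left hexpb hcr0) (by positivity) hee0) (by positivity) (by positivity)
      _ = (ζ₀ * ee * cr * ee) * r := by ring
      _ ≤ (ζ₀ * ee * cr * ee + 1) * r := mul_le_mul_of_nonneg_right (by linarith) hr
  have erate : ∀ y y' : Tor (TGIndex.Mn d hL i), Real.exp (-((ρ - ρ / 4 - ρ / 4) * tdistT (TGIndex.Mn d hL i) y y')) = Real.exp (-(ρ / 2 * tdistT (TGIndex.Mn d hL i) y y')) :=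
    fun y y' => by congr 1; ring
  have hZ₂ : HasMaj (BlockNorm.ofBlocks (unitTorusGeo L i.k (TGIndex.Mn d hL i)) (fun bb : Tor (TGIndex.Mn d hL i) × Fin (d + 1) => bb.1))
      (BlockNorm.ofBlocks (unitTorusGeo L i.k (TGIndex.Mn d hL i)) (fun bb : Tor (TGIndex.Mn d hL i) × Fin (d + 1) => bb.1))
      (zOp d (TGIndex.Mn d hL i) (L ^ i.k) b (blockAvg (kingPrV L i.k i.m (TGIndex.Mn d hL i)) c') (fun μ => blockAvg (kingPrV L i.k i.m (TGIndex.Mn d hL i)) (a' μ)))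
      (fun y y' => ζ * r * Real.exp (-(ρ / 2 * tdistT (TGIndex.Mn d hL i) y y'))) :=
    hZ.mono fun y y' => by rw [erate]; exact mul_le_mul_of_nonneg_right hZamp (Real.exp_nonneg _)
  have hZ'₂ : HasMaj (BlockNorm.ofBlocks (unitTorusGeo L i.k (TGIndex.Mn d hL i)) (fun bb : Tor (TGIndex.Mn d hL i) × Fin (d + 1) => bb.1))
      (BlockNorm.ofBlocks (unitTorusGeo L i.k (TGIndex.Mn d hL i)) (fun bb : Tor (TGIndex.Mn d hL i) × Fin (d + 1) => bb.1))
      (zOp d (TGIndex.Mn d hL i) (L ^ i.m * L ^ i.k) b c' a') (fun y y' => ζ * r * Real.exp (-(ρ / 2 * tdistT (TGIndex.Mn d hL i) y y'))) :=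
    hZ'.mono fun y y' => by rw [erate]; exact mul_le_mul_of_nonneg_right hZamp (Real.exp_nonneg _)
  have hζr0 : 0 ≤ ζ * r := mul_nonneg hζpos.le hr
  -- (iii) the η-difference (U-C `hasMaj_zOp_sub`): `𝔇(W′, W̄) = 𝔇(E₀′, Ē₀) − 𝔇(G′, Ḡ)` with K-J's entry 0
  have h₀ := HE i.mT i.k i.m i.one_le hL r hr hrrE oa hoa c' a' hc' ha' hfa none
  rw [hθ, hθ'] at h₀
  have h₀' : HasMaj (BlockNorm.ofBlocks (unitTorusGeo L i.k (TGIndex.Mn d hL i)) (blkFine L i.k (TGIndex.Mn d hL i)))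
      (BlockNorm.ofBlocks (unitTorusGeo L i.k (TGIndex.Mn d hL i)) (fun j : Tor (fine (L ^ i.m * L ^ i.k) (TGIndex.Mn d hL i)) × Fin (d + 1) => blockOf (L ^ i.m * L ^ i.k) (TGIndex.Mn d hL i) j.1))
      (idef (pull (kingPrV L i.k i.m (TGIndex.Mn d hL i))) (pull (kingPrV L i.k i.m (TGIndex.Mn d hL i)))
        (e0Op d (TGIndex.Mn d hL i) (L ^ i.m * L ^ i.k) b c' a')
        (e0Op d (TGIndex.Mn d hL i) (L ^ i.k) b (blockAvg (kingPrV L i.k i.m (TGIndex.Mn d hL i)) c') (fun μ => blockAvg (kingPrV L i.k i.m (TGIndex.Mn d hL i)) (a' μ))))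
      (fun y y' => BE * T * Real.exp (-(ρ / 2 * tdistT (TGIndex.Mn d hL i) y y'))) := by
    refine (h₀.congr fun v => (LinearMap.congr_fun (idef_e0Op_eq (M := TGIndex.Mn d hL i) (b := b) i.k i.m
      (blockAvg (kingPrV L i.k i.m (TGIndex.Mn d hL i)) c') (fun μ => blockAvg (kingPrV L i.k i.m (TGIndex.Mn d hL i)) (a' μ)) c' a') v).symm).mono fun y y' => ?_
    rw [← hT]
    exact mul_le_mul_of_nonneg_left (Real.exp_le_exp.mpr (neg_le_neg (mul_le_mul_of_nonneg_right (by linarith) (tdistT_nonneg (TGIndex.Mn d hL i) y y'))))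
      (mul_nonneg hBE.le hT0)
  have hDG₂ : HasMaj (BlockNorm.ofBlocks (unitTorusGeo L i.k (TGIndex.Mn d hL i)) (blkFine L i.k (TGIndex.Mn d hL i)))
      (BlockNorm.ofBlocks (unitTorusGeo L i.k (TGIndex.Mn d hL i)) (fun j : Tor (fine (L ^ i.m * L ^ i.k) (TGIndex.Mn d hL i)) × Fin (d + 1) => blockOf (L ^ i.m * L ^ i.k) (TGIndex.Mn d hL i) j.1))
      (idef (pull (kingPrV L i.k i.m (TGIndex.Mn d hL i))) (pull (kingPrV L i.k i.m (TGIndex.Mn d hL i)))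
        (gOp (TGIndex.Mn d hL i) (L ^ i.m * L ^ i.k) b) (gOp (TGIndex.Mn d hL i) (L ^ i.k) b))
      (fun y y' => m₀ * θ * Real.exp (-(ρ / 2 * tdistT (TGIndex.Mn d hL i) y y'))) := by
    rw [← blkFine_comp_kingPrV]
    refine hDG.mono fun y y' => mul_le_mul_of_nonneg_left (Real.exp_le_exp.mpr ?_) (mul_nonneg hm₀.le hθ0)
    have := tdistT_nonneg (TGIndex.Mn d hL i) y y'
    show -(δ * tdistT (TGIndex.Mn d hL i) y y') ≤ -(ρ / 2 * tdistT (TGIndex.Mn d hL i) y y')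
    nlinarith
  have hE : HasMaj (BlockNorm.ofBlocks (unitTorusGeo L i.k (TGIndex.Mn d hL i)) (blkFine L i.k (TGIndex.Mn d hL i)))
      (BlockNorm.ofBlocks (unitTorusGeo L i.k (TGIndex.Mn d hL i)) (fun j : Tor (fine (L ^ i.m * L ^ i.k) (TGIndex.Mn d hL i)) × Fin (d + 1) => blockOf (L ^ i.m * L ^ i.k) (TGIndex.Mn d hL i) j.1))
      (idef (pull (kingPrV L i.k i.m (TGIndex.Mn d hL i))) (pull (kingPrV L i.k i.m (TGIndex.Mn d hL i)))
        (wOp d (TGIndex.Mn d hL i) (L ^ i.m * L ^ i.k) b c' a')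
        (wOp d (TGIndex.Mn d hL i) (L ^ i.k) b (blockAvg (kingPrV L i.k i.m (TGIndex.Mn d hL i)) c') (fun μ => blockAvg (kingPrV L i.k i.m (TGIndex.Mn d hL i)) (a' μ))))
      (fun y y' => (BE + m₀) * T * Real.exp (-(ρ / 2 * tdistT (TGIndex.Mn d hL i) y y'))) := by
    refine ((h₀'.sub hDG₂).congr fun v => (LinearMap.congr_fun (idef_wOp_eq (M := TGIndex.Mn d hL i) (b := b) i.k i.m
      (blockAvg (kingPrV L i.k i.m (TGIndex.Mn d hL i)) c') (fun μ => blockAvg (kingPrV L i.k i.m (TGIndex.Mn d hL i)) (a' μ)) c' a') v).symm).mono fun y y' => ?_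
    have hE0 := Real.exp_nonneg (-(ρ / 2 * tdistT (TGIndex.Mn d hL i) y y'))
    have hmθ : m₀ * θ * Real.exp (-(ρ / 2 * tdistT (TGIndex.Mn d hL i) y y')) ≤ m₀ * T * Real.exp (-(ρ / 2 * tdistT (TGIndex.Mn d hL i) y y')) :=
      mul_le_mul_of_nonneg_right (mul_le_mul_of_nonneg_left hθT hm₀.le) hE0
    have e : (BE + m₀) * T * Real.exp (-(ρ / 2 * tdistT (TGIndex.Mn d hL i) y y'))
        = BE * T * Real.exp (-(ρ / 2 * tdistT (TGIndex.Mn d hL i) y y')) + m₀ * T * Real.exp (-(ρ / 2 * tdistT (TGIndex.Mn d hL i) y y')) := by ring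
    rw [e]
    exact add_le_add le_rfl hmθ
  -- the gradient letter of the coarse increment (U-C `hasMaj_grad_wOp_qvAdj`)
  have hunit := isUnit_pair (L := L) (M := TGIndex.Mn d hL i) i.k (blkFine L i.k (TGIndex.Mn d hL i)) hβ.le hr hσ (by linarith : ρ / 4 ≤ δ) hG hD hc ha hq
  have hVX := hasMaj_VX (L := L) (M := TGIndex.Mn d hL i) i.k (blkFine L i.k (TGIndex.Mn d hL i)) hβ.le hr hσ hρ₁ hρ₁δ hG hD hc ha hq
  rw [hA] at hVX
  have hDW := fun κ => hasMaj_grad_wOp_qvAdj (L := L) (M := TGIndex.Mn d hL i) i.k (σ := ρ / 4) (ρ := ρ - ρ / 4) (δ := δ) hβ.le hA0 hσ (by linarith) hρ₁δ hunit hD hVX κ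
  have hcast' : (((L ^ i.k : ℕ) : ℝ))⁻¹ = ((L : ℝ) ^ i.k)⁻¹ := by rw [hcast]
  have hDW₂ : ∀ κ, HasMaj (BlockNorm.ofBlocks (unitTorusGeo L i.k (TGIndex.Mn d hL i)) (fun bb : Tor (TGIndex.Mn d hL i) × Fin (d + 1) => bb.1))
      (BlockNorm.ofBlocks (unitTorusGeo L i.k (TGIndex.Mn d hL i)) (blkFine L i.k (TGIndex.Mn d hL i)))
      ((((L ^ i.k : ℕ) : ℝ)⁻¹ • symbOp (TGIndex.Mn d hL i) (L ^ i.k) (sD (TGIndex.Mn d hL i) (L ^ i.k) κ ((L ^ i.k : ℕ) : ℝ))) ∘ₗ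
        (wOp d (TGIndex.Mn d hL i) (L ^ i.k) b (blockAvg (kingPrV L i.k i.m (TGIndex.Mn d hL i)) c') (fun μ => blockAvg (kingPrV L i.k i.m (TGIndex.Mn d hL i)) (a' μ)) ∘ₗ
          qvAdjRe (TGIndex.Mn d hL i) (L ^ i.k)))
      (fun y y' => ((L : ℝ) ^ i.k)⁻¹ * (β * A * Real.exp (ρ - ρ / 4) * cr * cr) * Real.exp (-(ρ / 2 * tdistT (TGIndex.Mn d hL i) y y'))) := fun κ =>
    (hDW κ).mono fun y y' => le_of_eq (by rw [hcast', ← hcr, show ρ - ρ / 4 - ρ / 4 = ρ / 2 by ring]; ring)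
  have hβD0 : 0 ≤ ((L : ℝ) ^ i.k)⁻¹ * (β * A * Real.exp (ρ - ρ / 4) * cr * cr) := by positivity
  have hW'₂ := hW'.mono fun y y' => by
    have hdy : 0 ≤ tdistT (TGIndex.Mn d hL i) y y' := tdistT_nonneg _ y y'
    exact (mul_le_mul_of_nonneg_left (Real.exp_le_exp.mpr (by nlinarith) :
      Real.exp (-((ρ - ρ / 4) * tdistT (TGIndex.Mn d hL i) y y')) ≤ Real.exp (-(ρ / 2 * tdistT (TGIndex.Mn d hL i) y y'))) hBW0)
  have hmW0 : 0 ≤ (BE + m₀) * T := by positivity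
  have hsub := hasMaj_zOp_sub (L := L) (M := TGIndex.Mn d hL i) i.k i.m (σ := ρ / 4) (ρ := ρ / 2) hBW0 hmW0 hβD0 hσ (by linarith) hW'₂ hE hDW₂
  rw [hcr] at hsub
  -- the three amplitudes of the difference against `T`
  have hr₁W : ζ₀ * r ≤ ζ₀ * r₁ := mul_le_mul_of_nonneg_left hrr₁ hζ₀
  have hBW1 : BW ≤ ζ₀ * r₁ := hBWle.trans hr₁W
  have t1 : 1 * BW * (2 * Real.exp (ρ / 2) / (L : ℝ) ^ i.k * 1) * cr * Real.exp (ρ / 2 - ρ / 4) ≤ (ζ₀ * r₁ * 2 * ee * cr * ee) * T := by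
    have e : 1 * BW * (2 * Real.exp (ρ / 2) / (L : ℝ) ^ i.k * 1) * cr * Real.exp (ρ / 2 - ρ / 4)
        = 2 * cr * (BW * (Real.exp (ρ / 2) * (Real.exp (ρ / 2 - ρ / 4) * ((L : ℝ) ^ i.k)⁻¹))) := by rw [div_eq_mul_inv]; ring
    rw [e]
    calc 2 * cr * (BW * (Real.exp (ρ / 2) * (Real.exp (ρ / 2 - ρ / 4) * ((L : ℝ) ^ i.k)⁻¹)))
        ≤ 2 * cr * ((ζ₀ * r₁) * (ee * (ee * T))) := mul_le_mul_of_nonneg_left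
          (mul_le_mul hBW1 (mul_le_mul hexpc (mul_le_mul hexpd (hθinv.trans hθT) hLinv0 hee0) (by positivity) hee0) (by positivity) (by positivity)) (by positivity)
      _ = _ := by ring
  have t2 : 1 * ((BE + m₀) * T) * (1 * Real.exp (ρ / 2)) * cr * Real.exp (ρ / 2 - ρ / 4) ≤ ((BE + m₀) * ee * cr * ee) * T := by
    have e : 1 * ((BE + m₀) * T) * (1 * Real.exp (ρ / 2)) * cr * Real.exp (ρ / 2 - ρ / 4) = ((BE + m₀) * cr * T) * (Real.exp (ρ / 2) * Real.exp (ρ / 2 - ρ / 4)) := by ring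
    rw [e]
    calc ((BE + m₀) * cr * T) * (Real.exp (ρ / 2) * Real.exp (ρ / 2 - ρ / 4)) ≤ ((BE + m₀) * cr * T) * (ee * ee) :=
          mul_le_mul_of_nonneg_left (mul_le_mul hexpc hexpd (Real.exp_nonneg _) hee0) (by positivity)
      _ = _ := by ring
  have hAle' : A ≤ 2 * β * ((d : ℝ) + 2) * r₁ := hAle.trans (mul_le_mul_of_nonneg_left hrr₁ (by positivity))
  have t3 : ((L : ℝ) ^ i.k)⁻¹ * (β * A * Real.exp (ρ - ρ / 4) * cr * cr) * Real.exp (ρ / 2) ≤ (β * (2 * β * ((d : ℝ) + 2) * r₁) * ee * cr * cr * ee) * T := by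
    have e : ((L : ℝ) ^ i.k)⁻¹ * (β * A * Real.exp (ρ - ρ / 4) * cr * cr) * Real.exp (ρ / 2) = (β * cr * cr) * (A * (Real.exp (ρ - ρ / 4) * (Real.exp (ρ / 2) * ((L : ℝ) ^ i.k)⁻¹))) := by
      ring
    rw [e]
    calc (β * cr * cr) * (A * (Real.exp (ρ - ρ / 4) * (Real.exp (ρ / 2) * ((L : ℝ) ^ i.k)⁻¹)))
        ≤ (β * cr * cr) * ((2 * β * ((d : ℝ) + 2) * r₁) * (ee * (ee * T))) := mul_le_mul_of_nonneg_left
          (mul_le_mul hAle' (mul_le_mul hexpa (mul_le_mul hexpc (hθinv.trans hθT) hLinv0 hee0) (by positivity) hee0) (by positivity) (by positivity)) (by positivity)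
      _ = _ := by ring
  have hsum : 1 * BW * (2 * Real.exp (ρ / 2) / (L : ℝ) ^ i.k * 1) * cr * Real.exp (ρ / 2 - ρ / 4)
      + 1 * ((BE + m₀) * T) * (1 * Real.exp (ρ / 2)) * cr * Real.exp (ρ / 2 - ρ / 4)
      + ((L : ℝ) ^ i.k)⁻¹ * (β * A * Real.exp (ρ - ρ / 4) * cr * cr) * Real.exp (ρ / 2) ≤ τ * T := by
    have h := add_le_add (add_le_add t1 t2) t3
    refine h.trans ?_
    have e : τ * T = (ζ₀ * r₁ * 2 * ee * cr * ee) * T + ((BE + m₀) * ee * cr * ee) * T + (β * (2 * β * ((d : ℝ) + 2) * r₁) * ee * cr * cr * ee) * T + T := by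
      rw [hτ]; ring
    rw [e]
    linarith
  have hτT0 : 0 ≤ τ * T := mul_nonneg hτpos.le hT0
  have hsub₂ : HasMaj (BlockNorm.ofBlocks (unitTorusGeo L i.k (TGIndex.Mn d hL i)) (fun bb : Tor (TGIndex.Mn d hL i) × Fin (d + 1) => bb.1))
      (BlockNorm.ofBlocks (unitTorusGeo L i.k (TGIndex.Mn d hL i)) (fun bb : Tor (TGIndex.Mn d hL i) × Fin (d + 1) => bb.1))
      (zOp d (TGIndex.Mn d hL i) (L ^ i.m * L ^ i.k) b c' a' -
        zOp d (TGIndex.Mn d hL i) (L ^ i.k) b (blockAvg (kingPrV L i.k i.m (TGIndex.Mn d hL i)) c') (fun μ => blockAvg (kingPrV L i.k i.m (TGIndex.Mn d hL i)) (a' μ)))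
      (fun y y' => τ * T * Real.exp (-(ρ / 4 * tdistT (TGIndex.Mn d hL i) y y'))) :=
    hsub.mono fun y y' => by
      have er : Real.exp (-((ρ / 2 - ρ / 4) * tdistT (TGIndex.Mn d hL i) y y')) = Real.exp (-(ρ / 4 * tdistT (TGIndex.Mn d hL i) y y')) := by
        congr 1; ring
      rw [er]
      exact mul_le_mul_of_nonneg_right hsum (Real.exp_nonneg _)
  -- the bond-matrix letters
  have hdec : ∀ p q : B4.Idx (pbox (TGIndex.Mn d hL i)) (d + 1),
      ζ * r * Real.exp (-(ρ / 2 * pdist (TGIndex.Mn d hL i) (one_le_M _) (p.1 : Fin (d + 1) → ℤ) (q.1 : Fin (d + 1) → ℤ)))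
        ≤ ζ * r * Real.exp (-(ρ / 4 * pdist (TGIndex.Mn d hL i) (one_le_M _) (p.1 : Fin (d + 1) → ℤ) (q.1 : Fin (d + 1) → ℤ))) := fun p q =>
    exp_decay_mono hζr0 (by linarith : ρ / 4 ≤ ρ / 2) (T4Cov2156Rate.bondDist_nonneg (one_le_M _) p q)
  refine ⟨fun p q => ?_, fun p q => ?_, fun p q => ?_⟩
  · exact (abs_unitBondMat_le_of_hasMaj (TGIndex.Mn d hL i) i.k hζr0 hZ₂ p q).trans (hdec p q)
  · exact (abs_unitBondMat_le_of_hasMaj (TGIndex.Mn d hL i) i.k hζr0 hZ'₂ p q).trans (hdec p q)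
  · rw [← Matrix.sub_apply, ← unitBondMat_sub, hθ, hθ', ← hT]
    exact abs_unitBondMat_le_of_hasMaj (TGIndex.Mn d hL i) i.k hτT0 hsub₂ p q

end Letters

end Summit.QuantumFields.YangMills.BalabanUVNodes.N15.UnitLayerBg

end
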